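import Summits.Ventures.PercRepro.ZFibre
import Summits.Ventures.PercRepro.StepiiCounterexample

/-!
# Lemma 5 on the gadget for EVERY weight vector: the `Z`-fibre copositivity certificate (p6, gen 5)

The gadget `g0` of `StepiiCounterexample.lean` (marks `0, 1, 2, 3`, hubs `4, 5`, `g = c–5` = edge
`3`) is the graph on which the CLASS-LEVEL form of Lemma 5 (the concavity of the C-011 slack `Φ⁺`
along `g`) fails: `not_summedStep_phiPlus` there.  This file proves that the PRODUCT-LEVEL Lemma 5
nevertheless holds on it for every weight vector `p ∈ [0, 1]⁸`:

* **`gadget_deltaQuad_nonpos`**: `Q⁺(Δ_g, Δ_g) ≤ 0` for every `p` with `IsProb p`;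
* **`gadget_phiPlus_concave`**: `t ↦ Φ⁺(p[g := t])` is concave on `[0, 1]` for every such `p`.

The certificate (`proofs/P6-attach-fibre.md` §2, `proofs/P6-gadget-lemma5.md`) is the `Z`-fibre
regrouping of `ZFibre.lean`: with the three edges `Z = {a–H, v–m₂, v–H}` (`g0` edges `4, 2, 7`) and
the four body edges `R = {a–m₁, H–m₄, m₁–m₂, H–m₁}` (`0, 1, 5, 6`), the body classes `(I ⊆ U ⊆ R)`
have INTEGER `Z`-fibre kernels — the `8 × 8` matrices
`Mtau I U z z′ = Σ_{τ ⊆ U ∖ I} kA(I ∪ τ ∪ z, I ∪ (U ∖ I ∖ τ) ∪ z′)`, `kA = 2 Q⁺` of two fully forced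
merge vectors read through the certified row table — and
`Q⁺(Δ_g, Δ_g) = ½ Σ_{I ⊆ U} w_R(I) w_R(U) Σ_{z, z′ ⊆ Z} P(z) P(z′) Mtau I U z z′`.
Of the 81 matrices, 80 are entrywise `≤ 0` and the last one (`I = ∅`, `U = R`: all four body edges
differ) has exactly two positive entries, `+1` at the exclusive pair `({v–H}, {a–H, v–m₂})` and its
transpose, against diagonal entries `−2, −2` (`fibreOKat_0..15`, `Mtau_block`: `16,384` kernel
values); the block `[[−2, 1], [1, −2]]` is negative semidefinite, so every class is nonpositive for
every nonnegative fibre law (`sum_nonpos_of_block`) — in particular for ANY joint law of the three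
`Z`-edges.  The class level fails because it asks each of the `256` classes of all seven edges to be
nonpositive; the `Z`-fibre certificate only asks it of the `81` body classes, each weighted by a
nonnegative quadratic form in the `Z`-pattern weights.
-/

-- the kernel checks below are heavy; elaborate them one at a time (memory; p3 g9 finding 21:02:37Z)
set_option Elab.async false

namespace PercRepro

open Finset

/-! ### The gadget: the `Z`-edges, the body, and the integer kernel on patterns -/

/-- The three `Z`-edges of the gadget `g0` (`StepiiCounterexample.lean` labels): `2 = a–5`
(the gadget's `v–m₂`), `4 = c–4` (`a–H`), `7 = 4–5` (`v–H`). -/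
def Zg : Finset (Fin 8) := {2, 4, 7}

/-- The four body edges: `0 = b–c` (`a–m₁`), `1 = d–4` (`H–m₄`), `5 = a–b` (`m₁–m₂`),
`6 = b–4` (`H–m₁`). -/
def Rg : Finset (Fin 8) := {0, 1, 5, 6}

/-- The body edges and the hub edges of the gadget partition the edge set `S0`. -/
theorem Rg_union_Zg : Rg ∪ Zg = S0 := by decide

/-- The body edges and the hub edges of the gadget are disjoint. -/
theorem disjoint_Rg_Zg : Disjoint Rg Zg := by decide

/-- The distinguished edge `3` is not a body edge. -/
theorem three_notMem_Rg : (3 : Fin 8) ∉ Rg := by decide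

/-- The distinguished edge `3` is not a hub edge. -/
theorem three_notMem_Zg : (3 : Fin 8) ∉ Zg := by decide

/-- The configuration of a pattern `A` on the seven free edges, with `g = 3` set to `b`. -/
def patCfg (A : Finset (Fin 8)) (b : Bool) : Config (Fin 8) :=
  fun e => if e = 3 then b else decide (e ∈ A)

/-- Opening `g` in a fully forced pattern gives the point mass at `patCfg A true`. -/
theorem update_forcePat_one (p : Fin 8 → ℝ) (A : Finset (Fin 8)) :
    Function.update (forcePat p S0 A) 3 (1 : ℝ) = detWeights (patCfg A true) := by
  funext e
  by_cases he : e = 3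
  · subst he
    simp [detWeights, patCfg]
  · have heS : e ∈ S0 := Finset.mem_erase.mpr ⟨he, Finset.mem_univ e⟩
    simp [forcePat, detWeights, patCfg, heS, he]

/-- Closing `g` in a fully forced pattern gives the point mass at `patCfg A false`. -/
theorem update_forcePat_zero (p : Fin 8 → ℝ) (A : Finset (Fin 8)) :
    Function.update (forcePat p S0 A) 3 (0 : ℝ) = detWeights (patCfg A false) := by
  funext e
  by_cases he : e = 3
  · subst he
    simp [detWeights, patCfg]
  · have heS : e ∈ S0 := Finset.mem_erase.mpr ⟨he, Finset.mem_univ e⟩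
    simp [forcePat, detWeights, patCfg, heS, he]

/-- The merge vector of a fully forced pattern is the difference of two basis rows, read through
the certified row table. -/
theorem deltaVec_forcePat_S0 (p : Fin 8 → ℝ) (A : Finset (Fin 8)) :
    g0.deltaVec (forcePat p S0 A) 3 0 1 2 3 =
      fun r => rowVec (rowT (patCfg A true)) r - rowVec (rowT (patCfg A false)) r := by
  funext r
  have h1 : row4 (g0.markedPartition (patCfg A true) ![0, 1, 2, 3]) = rowT (patCfg A true) := by
    rw [show (![0, 1, 2, 3] : Fin 4 → Fin 6) = m0 from rfl, rowD_eq, rowD_eq_table]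
  have h0 : row4 (g0.markedPartition (patCfg A false) ![0, 1, 2, 3]) = rowT (patCfg A false) := by
    rw [show (![0, 1, 2, 3] : Fin 4 → Fin 6) = m0 from rfl, rowD_eq, rowD_eq_table]
  simp only [MultiGraph.deltaVec, update_forcePat_one, update_forcePat_zero,
    MultiGraph.law4_detWeights, rowVec, h1, h0]

/-- The integer kernel on pairs of free-edge patterns: `kA A A′ = 2 Q⁺(Δ_A, Δ_{A′})`. -/
def kA (A A' : Finset (Fin 8)) : ℤ :=
  kplus (rowT (patCfg A true)) (rowT (patCfg A' true)) - kplus (rowT (patCfg A true)) (rowT (patCfg A' false)) -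
    kplus (rowT (patCfg A false)) (rowT (patCfg A' true)) + kplus (rowT (patCfg A false)) (rowT (patCfg A' false))

/-- `Q⁺` of two fully forced merge vectors is half the integer kernel. -/
theorem quadPlus_forcePat_S0 (p : Fin 8 → ℝ) (A A' : Finset (Fin 8)) :
    quadPlus (g0.deltaVec (forcePat p S0 A) 3 0 1 2 3) (g0.deltaVec (forcePat p S0 A') 3 0 1 2 3) =
      (1 / 2 : ℝ) * (kA A A' : ℝ) := by
  rw [deltaVec_forcePat_S0, deltaVec_forcePat_S0, quadPlus_basis, kA]
  push_cast
  ring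

/-! ### The `Z`-fibre kernels of the body classes -/

/-- The `Z`-fibre kernel of the body class `(I, U)` at the `Z`-patterns `(z, z′)`: the sum of `kA`
over the ordered pairs of body patterns with intersection `I` and union `U`. -/
def Mfib (I U z z' : Finset (Fin 8)) : ℤ :=
  ∑ AA ∈ (Rg.powerset ×ˢ Rg.powerset).filter
      (fun AA : Finset (Fin 8) × Finset (Fin 8) => (AA.1 ∩ AA.2, AA.1 ∪ AA.2) = (I, U)),
    kA (AA.1 ∪ z) (AA.2 ∪ z')

/-- The same kernel parametrised by the differing body edges open in the first copy (the form the
kernel evaluates). -/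
def Mtau (I U z z' : Finset (Fin 8)) : ℤ :=
  ∑ τ ∈ (U \ I).powerset, kA (I ∪ τ ∪ z) (I ∪ ((U \ I) \ τ) ∪ z')

/-- On the body classes the fibre kernel agrees with the τ-kernel. -/
theorem Mfib_eq_Mtau {I U : Finset (Fin 8)} (hI : I ⊆ U) (hU : U ⊆ Rg) (z z' : Finset (Fin 8)) :
    Mfib I U z z' = Mtau I U z z' := by
  unfold Mfib Mtau
  exact sum_fibre_eq Rg hI hU (fun AA => kA (AA.1 ∪ z) (AA.2 ∪ z'))

/-- The fibre kernel vanishes off the classes `I ⊆ U`. -/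
theorem Mfib_eq_zero_of_not_subset {I U : Finset (Fin 8)} (h : ¬ I ⊆ U) (z z' : Finset (Fin 8)) :
    Mfib I U z z' = 0 := by
  unfold Mfib
  refine Finset.sum_eq_zero fun AA hAA => ?_
  exfalso
  have h' := (Finset.mem_filter.mp hAA).2
  simp only [Prod.mk.injEq] at h'
  apply h
  rw [← h'.1, ← h'.2]
  exact Finset.inter_subset_left.trans Finset.subset_union_left

/-- On the gadget the `Z`-fibre kernels are half the integer fibre kernels. -/
theorem fibreKernel_g0 (p : Fin 8 → ℝ) (I U z z' : Finset (Fin 8)) :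
    g0.fibreKernel p Rg Zg 3 0 1 2 3 I U z z' = (1 / 2 : ℝ) * (Mfib I U z z' : ℝ) := by
  unfold MultiGraph.fibreKernel Mfib
  push_cast
  rw [Finset.mul_sum]
  refine Finset.sum_congr rfl fun AA _ => ?_
  rw [Rg_union_Zg, quadPlus_forcePat_S0]

/-! ### The kernel computation: 80 nonpositive matrices and one dominated block -/

/-- The `Z`-pattern `{v–H}` (edge `7` only). -/
def z₁ : Finset (Fin 8) := {7}

/-- The `Z`-pattern `{v–m₂, a–H}` (edges `2` and `4`). -/
def z₂ : Finset (Fin 8) := {2, 4}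

/-- The sixteen subsets of the body `R`, as literals. -/
def subsetsR : List (Finset (Fin 8)) :=
  [∅,
   {0},
   {1},
   {5},
   {6},
   {0, 1},
   {0, 5},
   {0, 6},
   {1, 5},
   {1, 6},
   {5, 6},
   {0, 1, 5},
   {0, 1, 6},
   {0, 5, 6},
   {1, 5, 6},
   {0, 1, 5, 6}]

/-- The eight subsets of `Z`, as literals. -/
def subsetsZ : List (Finset (Fin 8)) := [∅, {2}, {4}, {7}, {2, 4}, {2, 7}, {4, 7}, {2, 4, 7}]

/-- Every subset of the body edges is listed in `subsetsR` (kernel-checked). -/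
theorem mem_subsetsR_of_mem_powerset : ∀ I ∈ Rg.powerset, I ∈ subsetsR := by
  decide +kernel

/-- Every subset of the hub edges is listed in `subsetsZ` (kernel-checked). -/
theorem mem_subsetsZ_of_mem_powerset : ∀ z ∈ Zg.powerset, z ∈ subsetsZ := by
  decide +kernel

/-- The closed Boolean check of the `64` fibre entries of the body classes with sure set `I`
(the form the kernel evaluates; one theorem per `I` below). -/
def fibreOKat (I : Finset (Fin 8)) : Bool :=
  subsetsR.all fun U => !(decide (I ⊆ U)) || subsetsZ.all fun z => subsetsZ.all fun z' =>
    decide (I = ∅ ∧ U = Rg ∧ ((z = z₁ ∧ z' = z₂) ∨ (z = z₂ ∧ z' = z₁))) || decide (Mtau I U z z' ≤ 0)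

/-- Fibre check of the gadget certificate at body index `0` (kernel-checked). -/ theorem fibreOKat_0 : fibreOKat ∅ = true := by
  decide +kernel

/-- Fibre check of the gadget certificate at body index `1` (kernel-checked). -/ theorem fibreOKat_1 : fibreOKat {0} = true := by
  decide +kernel

/-- Fibre check of the gadget certificate at body index `2` (kernel-checked). -/ theorem fibreOKat_2 : fibreOKat {1} = true := by
  decide +kernel

/-- Fibre check of the gadget certificate at body index `3` (kernel-checked). -/ theorem fibreOKat_3 : fibreOKat {5} = true := by
  decide +kernel

/-- Fibre check of the gadget certificate at body index `4` (kernel-checked). -/ theorem fibreOKat_4 : fibreOKat {6} = true := by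
  decide +kernel

/-- Fibre check of the gadget certificate at body index `5` (kernel-checked). -/ theorem fibreOKat_5 : fibreOKat {0, 1} = true := by
  decide +kernel

/-- Fibre check of the gadget certificate at body index `6` (kernel-checked). -/ theorem fibreOKat_6 : fibreOKat {0, 5} = true := by
  decide +kernel

/-- Fibre check of the gadget certificate at body index `7` (kernel-checked). -/ theorem fibreOKat_7 : fibreOKat {0, 6} = true := by
  decide +kernel

/-- Fibre check of the gadget certificate at body index `8` (kernel-checked). -/ theorem fibreOKat_8 : fibreOKat {1, 5} = true := by
  decide +kernel

/-- Fibre check of the gadget certificate at body index `9` (kernel-checked). -/ theorem fibreOKat_9 : fibreOKat {1, 6} = true := by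
  decide +kernel

/-- Fibre check of the gadget certificate at body index `10` (kernel-checked). -/ theorem fibreOKat_10 : fibreOKat {5, 6} = true := by
  decide +kernel

/-- Fibre check of the gadget certificate at body index `11` (kernel-checked). -/ theorem fibreOKat_11 : fibreOKat {0, 1, 5} = true := by
  decide +kernel

/-- Fibre check of the gadget certificate at body index `12` (kernel-checked). -/ theorem fibreOKat_12 : fibreOKat {0, 1, 6} = true := by
  decide +kernel

/-- Fibre check of the gadget certificate at body index `13` (kernel-checked). -/ theorem fibreOKat_13 : fibreOKat {0, 5, 6} = true := by
  decide +kernel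

/-- Fibre check of the gadget certificate at body index `14` (kernel-checked). -/ theorem fibreOKat_14 : fibreOKat {1, 5, 6} = true := by
  decide +kernel

/-- Fibre check of the gadget certificate at body index `15` (kernel-checked). -/ theorem fibreOKat_15 : fibreOKat {0, 1, 5, 6} = true := by
  decide +kernel

/-- The fibre check passes for every listed body class (case split over the 16 indices). -/
theorem fibreOKat_of_mem : ∀ I ∈ subsetsR, fibreOKat I = true := by
  intro I hI
  simp only [subsetsR, List.mem_cons, List.not_mem_nil, or_false] at hI
  rcases hI with rfl | rfl | rfl | rfl | rfl | rfl | rfl | rfl | rfl | rfl | rfl | rfl | rfl | rfl |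
    rfl | rfl
  exacts [fibreOKat_0, fibreOKat_1, fibreOKat_2, fibreOKat_3, fibreOKat_4, fibreOKat_5, fibreOKat_6, fibreOKat_7, fibreOKat_8, fibreOKat_9, fibreOKat_10, fibreOKat_11, fibreOKat_12, fibreOKat_13, fibreOKat_14, fibreOKat_15]

/-- **Every `Z`-fibre entry of every body class is `≤ 0`**, except the two off-diagonal entries
`(z₁, z₂)`, `(z₂, z₁)` of the all-differ class `(∅, R)` (kernel computation: `81` classes `×`
`64` pattern pairs, `16,384` kernel values through the certified row table). -/
theorem Mtau_nonpos : ∀ I ∈ Rg.powerset, ∀ U ∈ Rg.powerset, I ⊆ U →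
    ∀ z ∈ Zg.powerset, ∀ z' ∈ Zg.powerset,
      ¬ (I = ∅ ∧ U = Rg ∧ ((z = z₁ ∧ z' = z₂) ∨ (z = z₂ ∧ z' = z₁))) → Mtau I U z z' ≤ 0 := by
  intro I hI U hU hIU z hz z' hz' hne
  have h := fibreOKat_of_mem I (mem_subsetsR_of_mem_powerset I hI)
  unfold fibreOKat at h
  rw [List.all_eq_true] at h
  have h := h U (mem_subsetsR_of_mem_powerset U hU)
  rw [Bool.or_eq_true, Bool.not_eq_true', decide_eq_false_iff_not, List.all_eq_true] at h
  rcases h with h | h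
  · exact absurd hIU h
  have h := h z (mem_subsetsZ_of_mem_powerset z hz)
  rw [List.all_eq_true] at h
  have h := h z' (mem_subsetsZ_of_mem_powerset z' hz')
  rw [Bool.or_eq_true, decide_eq_true_eq, decide_eq_true_eq] at h
  rcases h with h | h
  · exact absurd h hne
  · exact h

/-- **The exceptional block** of the all-differ class: `+1` off the diagonal (the exclusive pair
`v–H` alone against `a–H` with `v–m₂`), `−2` on it. -/
theorem Mtau_block : Mtau ∅ Rg z₁ z₂ = 1 ∧ Mtau ∅ Rg z₂ z₁ = 1 ∧ Mtau ∅ Rg z₁ z₁ = -2 ∧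
    Mtau ∅ Rg z₂ z₂ = -2 := by
  decide +kernel

/-- Every body class is nonpositive for every nonnegative `Z`-pattern law. -/
theorem class_nonpos (p : Fin 8 → ℝ) (hp : IsProb p) {I U : Finset (Fin 8)} (hI : I ⊆ U)
    (hU : U ⊆ Rg) :
    ∑ z ∈ Zg.powerset, ∑ z' ∈ Zg.powerset,
      patWeight p Zg z * patWeight p Zg z' * (Mtau I U z z' : ℝ) ≤ 0 := by
  have hIm : I ∈ Rg.powerset := Finset.mem_powerset.mpr (hI.trans hU)
  have hUm : U ∈ Rg.powerset := Finset.mem_powerset.mpr hU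
  by_cases hspec : I = ∅ ∧ U = Rg
  · obtain ⟨rfl, rfl⟩ := hspec
    refine sum_nonpos_of_block Zg.powerset (patWeight p Zg) (patWeight_nonneg hp Zg)
      (fun z z' => (Mtau ∅ Rg z z' : ℝ)) (i₁ := z₁) (i₂ := z₂) (by decide) (by decide) (by decide)
      ?_ ?_ ?_ ?_ ?_
    · intro z hz z' hz' hne
      have := Mtau_nonpos ∅ hIm Rg hUm hI z hz z' hz' (fun h => hne h.2.2)
      exact_mod_cast this
    · have := Mtau_block.2.2.1
      exact_mod_cast this.le
    · have := Mtau_block.2.2.2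
      exact_mod_cast this.le
    · have := Mtau_block.1
      exact_mod_cast this.le
    · have := Mtau_block.2.1
      exact_mod_cast this.le
  · refine Finset.sum_nonpos fun z hz => Finset.sum_nonpos fun z' hz' => ?_
    refine mul_nonpos_of_nonneg_of_nonpos
      (mul_nonneg (patWeight_nonneg hp _ _) (patWeight_nonneg hp _ _)) ?_
    have := Mtau_nonpos I hIm U hUm hI z hz z' hz' (fun h => hspec ⟨h.1, h.2.1⟩)
    exact_mod_cast this

/-! ### Lemma 5 on the gadget -/

/-- **Lemma 5 on the gadget for every weight vector**: `Q⁺(Δ_g, Δ_g) ≤ 0` along `g = c–5` on `g0`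
for every `p ∈ [0, 1]⁸` (the class-level form fails here, `not_summedStep_phiPlus`). -/
theorem gadget_deltaQuad_nonpos (p : Fin 8 → ℝ) (hp : IsProb p) :
    g0.deltaQuad p 3 0 1 2 3 ≤ 0 := by
  refine g0.deltaQuad_nonpos_of_fibreKernel hp disjoint_Rg_Zg three_notMem_Rg three_notMem_Zg
    0 1 2 3 fun I hI U hU => ?_
  have hU' : U ⊆ Rg := Finset.mem_powerset.mp hU
  simp only [fibreKernel_g0]
  by_cases hsub : I ⊆ U
  · have hM : ∀ z z', (Mfib I U z z' : ℝ) = (Mtau I U z z' : ℝ) :=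
      fun z z' => by rw [Mfib_eq_Mtau hsub hU']
    simp only [hM]
    have := class_nonpos p hp hsub hU'
    have hhalf : ∀ z z' : Finset (Fin 8), patWeight p Zg z * patWeight p Zg z' *
        ((1 / 2 : ℝ) * (Mtau I U z z' : ℝ)) =
          (1 / 2 : ℝ) * (patWeight p Zg z * patWeight p Zg z' * (Mtau I U z z' : ℝ)) :=
      fun z z' => by ring
    simp only [hhalf, ← Finset.mul_sum]
    linarith
  · simp only [Mfib_eq_zero_of_not_subset hsub, Int.cast_zero, mul_zero, Finset.sum_const_zero,
      le_refl]

/-- **The C-011 slack is concave in the weight of `g = c–5` on the gadget**, for every `p`. -/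
theorem gadget_phiPlus_concave (p : Fin 8 → ℝ) (hp : IsProb p) :
    ConcaveOn ℝ (Set.Icc (0 : ℝ) 1) (fun t => g0.PhiPlus (Function.update p 3 t) 0 1 2 3) :=
  (g0.concaveOn_phiPlus_iff p 3 0 1 2 3).mpr (gadget_deltaQuad_nonpos p hp)

end PercRepro
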